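import Summits.QuantumFields.YangMills.Theorems.BalabanUVNodesN11CondExpFibreSections
import Summits.QuantumFields.YangMills.Theorems.BalabanUVNodesN11GaugeFixingSeparatedAtRecord

/-!
# DAG node N11 — THE FROZEN-`y` SECTIONS OF THE SKEW CONDITIONAL EXPECTATION AT 11a's GENERATION LETTERS `sV = B_k(Ω^c_{k+1}(s′))`, `sV' = B_{k+1}(Ω^c_{k+1}(s′))`:
# (hce₀) ⟺ (hfib) with dag-n11-d's names, the fibre transports as the candidate, the displayed hypotheses INHABITED

HEADER — WORK-UNIT METADATA.  Cell `pub-ymgap`, YM-PLAN Track A (HUMAN RULING D-0062), seat `pub-ymgap-dag-n11-e` (g23; R134 fan-out seat N11 [B14], strategy s3), route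
`BalabanUVNodes`, item K1⁹ `StabilityBRunRowsAtRecordR13SepCoPHV` = stmt-QuantumFields-27364 (helper lane, `--kind proof --supports 27364 --as helper`, count-neutral).
[I] = [Balaban1987RG1], [III] = [Balaban1988Convergent].  FILE 3 of 3, over FILE 2 `…N11CondExpFibreSections` (sections = fibre transports; record letters), this seat's g22 p624257 `…N11GaugeFixingSeparatedAtRecord`, dag-n11-d g17's
p649025 `…N11CondExpOfFibrewiseIdentity` (`condExp_identity_of_fibrewise[_of_nonneg]` — (hfib) ⇒ (hce₀) at these letters) and this seat's g21 p615032
`…N11AveragingSkewPresentationAtRecord` (`toFine_mem_compl_Omega_iff` — the saturation of `(Ω_{k+1}(s′))ᶜ`; `map_prod_avOfRecord_glue_skew_absolutelyContinuous_Omega` — joint AC).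

WHY THIS FILE.  dag-n11-d's (hce₀) ∕ (hfib) are keyed to a history `s′` of length `k+1` and the generation letters of 11a's `genDataOfRecord`: retained fine variables on
`sV = (bondsIn k (Ω_{k+1}(s′))ᶜ).toFinset`, new coarse variables off `sV' = (bondsIn (k+1) (Ω_{k+1}(s′))ᶜ).toFinset`.  At these letters every structural hypothesis of FILE 2 is a
THEOREM (`Y := (Ω_{k+1}(s′))ᶜ` is saturated at level `k+1` because `Ω_{k+1}(s′)` is a union of `L^{k+1}`-cubes; `sV ⊆ B_k(Y)` and `B_{k+1}(Y) ⊆ sV'` with equality), so this file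
states, hypothesis-free but for `k + 1 ≤ m + K`: the fibre maps are absolutely continuous for EVERY frozen `y`; the sections of def-T's skew conditional expectation of ANY integrable
`ρ ∘ e` are the fibre transports; (hce₀) ⟺ (hfib) — the backward implication being dag-n11-d's theorem BY NAME, the forward one FILE 2's; and the displayed hypotheses (hfib) of
p649025 ∕ (hweak) of p646357 are INHABITED by the true candidate `R := kernelTransport μ_in μ_out skew (ρ ∘ e)` for every integrable `ρ` (ref-K READ-318 on p649025, A2: «a
non-trivial record witness NOT EXHIBITED» — exhibited here; the witness is the conditional expectation itself, so the CONTENT of (hfib) with the supplier's `R̃_{S₀}` is exactly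
«the fibre transport of the old graph piece at frozen `y` equals `R̃_{S₀}(y,·)`» — [I] §2 + gauge fixing + `ζ` + [III] Thm 2, untouched).

WHAT THIS FILE PROVES (0 `def`, 0 `sorry`, standard axioms).
§1 `map_pi_avOfRecord_glue_fibre_absolutelyContinuous_bondsIn` · ★ `map_pi_avOfRecord_glue_fibre_absolutelyContinuous_Omega` (fibre AC for every frozen `y`, any history, any level
   `j + 1 ≤ m + K`).
§2 (dag-n11-d's letters: `ν M g p`, `hk : k + 1 ≤ m + K`, `s′ : SeqOfRecord F ν M g p.K (k+1)`, ANY `dU`-integrable `ρ`): ★★★ `ae_condExp_section_ae_eq_fibreTransport_Omega` ·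
   ★★★ `fibrewise_of_condExp_Omega` ((hce₀) ⇒ (hfib)) · ★★★ `condExp_iff_fibrewise_Omega` (candidate integrable; `.mpr` = dag-n11-d's `condExp_identity_of_fibrewise`) ·
   ★★★ `condExp_iff_fibrewise_of_nonneg_Omega` (`.mpr` = `condExp_identity_of_fibrewise_of_nonneg`) · ★★ `weak_kernelTransport_Omega` ((hweak) of p646357 with the true
   candidate) · ★★ `fibrewise_kernelTransport_Omega` ((hfib) of p649025 with the true candidate).
§3 ★★ `ae_fibreTransport_fpWeight_mul_ae_eq_Omega` (the soft gauge-fixing law of [III] p.265 L.10–12 ∕ (1.5)⇒(1.6) FIBRE BY FIBRE: this seat's p624257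
   `innerTransport_fpWeight_mul_ae_eq_bondsIn_Omega` read through FILE 2's ★★★ — inserting the Faddeev–Popov weight leaves a.e. every fibre transport unchanged).

HONEST FRAMING.  Helper lane of K1⁹; count-neutral; compositions BY NAME of FILE 1–2, dag-n11-d's p649025 and this seat's p615032; [folklore] measure theory over def-T's
DEFINITIONS; nothing of Bałaban's ([I] §2, [III] Thm 2 ∕ (3.10)–(3.25)) asserted; (O3′) NOT closed; N11 NOT discharged; K1⁹ NOT closed, no registered stub touched; counts unmoved
(typed 28∕28 · discharged 5∕27 · A 5∕28).  One finite `𝕋⁴_{L^K}` programme at fixed `ε = L^{−K}`; R4 closes only the conditional finite-𝕋⁴ rung `BalabanLadder.UV` — NOT ℝ⁴,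
NOT OS, NOT a mass gap, NOT Clay.  No `sorry`, `axiom`, `def`, `instance`, `notation`.
Sources (SHAPE ∕ bookkeeping only): [III] (2.18) p.257, (2.20)–(2.21) p.258, (3.1) p.264, (3.10)–(3.11) p.266, (3.12)–(3.14) p.267, (3.23)–(3.25) p.270; [I] (0.4) p.253, §2 p.267.
-/

noncomputable section

open MeasureTheory ProbabilityTheory
open scoped ENNReal NNReal BigOperators

namespace Summit.QuantumFields.YangMills.Theorems.BalabanUVNodesN11CondExpFibreSectionsOmega

open Literature.MathematicalPhysics.QuantumFieldTheory.Balaban1983to89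
open Literature.MathematicalPhysics.QuantumFieldTheory.Balaban1983to89.T4AveragingDisintegration
open BalabanUVNodesN11CondExpOfFibrewiseIdentity (condExp_identity_of_fibrewise condExp_identity_of_fibrewise_of_nonneg)
open BalabanUVNodesN11CondExpFibreSections (map_pi_avOfRecord_glue_fibre_absolutelyContinuous ae_condExp_section_ae_eq_fibreTransport_at_record
  fibrewise_of_condExp_at_record condExp_iff_fibrewise_at_record weak_kernelTransport_skew ae_fibreTransport_congr_of_skew_ae_eq)
open BalabanUVNodesN11GaugeFixingSeparatedAtRecord (innerTransport_fpWeight_mul_ae_eq_bondsIn_Omega)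
open B12FaddeevPopov016 (FineGauge fpIntegrand)
open GaugeField (gaugeAct)
open B14Eq16FaddeevPopov (integrable_weight_mul)
open BalabanUVNodesN11AveragingSkewPresentationAtRecord (toFine_mem_compl_Omega_iff map_prod_avOfRecord_glue_skew_absolutelyContinuous_Omega)
open Node00 hiding SU
open Node00.Tk T4Continuum BlockAveraging
open B10Eq42TorusConstraint (bondsIn)
open B10Eq38TorusDomains (toFine)

variable {F : T4Family} {N : ℕ} [NeZero N]

/-! ## §1  Fibre absolute continuity at the bond sets of record of a saturated region, and at `Y = (Ω_{j+1}(s))ᶜ` -/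

section FibreAC

/-- ★ Fibre AC for every frozen `y` at the bond sets of record `sV = (bondsIn j Y).toFinset`, `sV' = (bondsIn (j+1) Y).toFinset` of a saturated region `Y`.
[cite: Balaban1987RG1, (0.4) p.253; Balaban1988Convergent, (2.21) p.258, (3.1) p.264 (bookkeeping)] -/
theorem map_pi_avOfRecord_glue_fibre_absolutelyContinuous_bondsIn (K j : ℕ) [DecidableEq (PBond (F.P K) j)] [DecidableEq (PBond (F.P K) (j + 1))]
    (hj : j + 1 ≤ (F.P K).m + (F.P K).K)
    {Y : Set (Site (F.P K) 0)} (hY : ∀ x : Site (F.P K) j, toFine j x ∈ Y ↔ toFine (j + 1) (blockOf x) ∈ Y)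
    (y : ↥(Set.toFinite (bondsIn j Y)).toFinset → SU N) :
    (Measure.pi fun _ : {b : PBond (F.P K) j // b ∉ (Set.toFinite (bondsIn j Y)).toFinset} => (HaarData.haar : Measure (SU N))).map
        (fun u => fun c : {c : PBond (F.P K) (j + 1) // c ∉ (Set.toFinite (bondsIn (j + 1) Y)).toFinset} =>
          (avOfRecord F N K j).avg ((MeasurableEquiv.piEquivPiSubtypeProd (fun _ : PBond (F.P K) j => SU N)
            (· ∈ (Set.toFinite (bondsIn j Y)).toFinset)).symm (y, u)) c) ≪
      Measure.pi fun _ : {c : PBond (F.P K) (j + 1) // c ∉ (Set.toFinite (bondsIn (j + 1) Y)).toFinset} => (HaarData.haar : Measure (SU N)) :=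
  map_pi_avOfRecord_glue_fibre_absolutelyContinuous F N K j hj hY (fun b hb => (mem_toFinite_bondsIn_toFinset_iff Y b).1 hb)
    (fun c hc => (mem_toFinite_bondsIn_toFinset_iff Y c).2 hc) y

/-- ★ **FIBRE AC FOR EVERY FROZEN `y` AT `Y = (Ω_{j+1}(s))ᶜ`** — hypothesis-free but for `j + 1 ≤ m + K` (saturation by p615032's `toFine_mem_compl_Omega_iff`), any history `s`
of any length, any torus `K`. [cite: Balaban1987RG1, (0.4) p.253; Balaban1988Convergent, (2.1) p.254, (2.21) p.258, (3.1) p.264 (bookkeeping)] -/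
theorem map_pi_avOfRecord_glue_fibre_absolutelyContinuous_Omega {ν : Stage7Numerics} {M : ℕ} {g : ℕ → ℝ} (K : ℕ) {n : ℕ} (s : SeqOfRecord F ν M g K n)
    (j : ℕ) [DecidableEq (PBond (F.P K) j)] [DecidableEq (PBond (F.P K) (j + 1))] (hj : j + 1 ≤ (F.P K).m + (F.P K).K)
    (y : ↥(Set.toFinite (bondsIn j (s.Ω (j + 1))ᶜ)).toFinset → SU N) :
    (Measure.pi fun _ : {b : PBond (F.P K) j // b ∉ (Set.toFinite (bondsIn j (s.Ω (j + 1))ᶜ)).toFinset} => (HaarData.haar : Measure (SU N))).map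
        (fun u => fun c : {c : PBond (F.P K) (j + 1) // c ∉ (Set.toFinite (bondsIn (j + 1) (s.Ω (j + 1))ᶜ)).toFinset} =>
          (avOfRecord F N K j).avg ((MeasurableEquiv.piEquivPiSubtypeProd (fun _ : PBond (F.P K) j => SU N)
            (· ∈ (Set.toFinite (bondsIn j (s.Ω (j + 1))ᶜ)).toFinset)).symm (y, u)) c) ≪
      Measure.pi fun _ : {c : PBond (F.P K) (j + 1) // c ∉ (Set.toFinite (bondsIn (j + 1) (s.Ω (j + 1))ᶜ)).toFinset} => (HaarData.haar : Measure (SU N)) :=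
  map_pi_avOfRecord_glue_fibre_absolutelyContinuous_bondsIn K j hj (toFine_mem_compl_Omega_iff s hj) y

end FibreAC

/-! ## §2  At dag-n11-d's letters: sections, (hce₀) ⟺ (hfib), and the true candidate -/

section Omega

/-- ★★★ **THE SECTIONS OF THE SKEW CONDITIONAL EXPECTATION ARE THE FIBRE TRANSPORTS, at 11a's generation letters**: for ANY `dU`-integrable `ρ` and a.e. retained configuration
`y ∈ SU(N)^{B_k(Ω^c_{k+1}(s′))}`, `(v ↦ kernelTransport μ_in μ_out skew (ρ ∘ e) (y,v)) =ᵐ kernelTransport (⊗_{b ∉ sV} dU) (⊗_{c ∉ sV'} dV) (u ↦ (Ū(e(y,u))(c))_{c ∉ sV'}) (u ↦ ρ(e(y,u)))`.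
[cite: Balaban1988Convergent, (2.21) p.258, (3.1) p.264, (3.10)–(3.14) pp.266–267, (3.23)–(3.25) p.270; Balaban1987RG1, (0.4) p.253, §2 p.267] -/
theorem ae_condExp_section_ae_eq_fibreTransport_Omega (ν : Stage7Numerics) (M : ℕ) (g : ℕ → ℝ) (p : B12.RunParams)
    {k : ℕ} {hdec : DecidableEq (PBond (F.P p.K) k)} {hdec' : DecidableEq (PBond (F.P p.K) (k + 1))} (hk : k + 1 ≤ (F.P p.K).m + (F.P p.K).K)
    (s' : SeqOfRecord F ν M g p.K (k + 1)) {ρ : GaugeField (F.P p.K) k (SU N) → ℝ} (hρ : Integrable ρ (fieldMeasure (F.P p.K) k (SU N))) :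
    ∀ᵐ y ∂(Measure.pi fun _ : ↥(Set.toFinite (bondsIn k (s'.Ω (k + 1))ᶜ)).toFinset => (HaarData.haar : Measure (SU N))),
      (fun v => kernelTransport
          ((Measure.pi fun _ : ↥(Set.toFinite (bondsIn k (s'.Ω (k + 1))ᶜ)).toFinset => (HaarData.haar : Measure (SU N))).prod
            (Measure.pi fun _ : {b : PBond (F.P p.K) k // b ∉ (Set.toFinite (bondsIn k (s'.Ω (k + 1))ᶜ)).toFinset} => (HaarData.haar : Measure (SU N))))
          ((Measure.pi fun _ : ↥(Set.toFinite (bondsIn k (s'.Ω (k + 1))ᶜ)).toFinset => (HaarData.haar : Measure (SU N))).prod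
            (Measure.pi fun _ : {c : PBond (F.P p.K) (k + 1) // c ∉ (Set.toFinite (bondsIn (k + 1) (s'.Ω (k + 1))ᶜ)).toFinset} =>
              (HaarData.haar : Measure (SU N))))
          (fun q => (q.1, fun c : {c : PBond (F.P p.K) (k + 1) // c ∉ (Set.toFinite (bondsIn (k + 1) (s'.Ω (k + 1))ᶜ)).toFinset} =>
            (avOfRecord F N p.K k).avg
              ((MeasurableEquiv.piEquivPiSubtypeProd (fun _ : PBond (F.P p.K) k => SU N)
                (· ∈ (Set.toFinite (bondsIn k (s'.Ω (k + 1))ᶜ)).toFinset)).symm q) c))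
          (ρ ∘ ⇑(MeasurableEquiv.piEquivPiSubtypeProd (fun _ : PBond (F.P p.K) k => SU N)
              (· ∈ (Set.toFinite (bondsIn k (s'.Ω (k + 1))ᶜ)).toFinset)).symm) (y, v)) =ᵐ[
        Measure.pi fun _ : {c : PBond (F.P p.K) (k + 1) // c ∉ (Set.toFinite (bondsIn (k + 1) (s'.Ω (k + 1))ᶜ)).toFinset} => (HaarData.haar : Measure (SU N))]
      kernelTransport
        (Measure.pi fun _ : {b : PBond (F.P p.K) k // b ∉ (Set.toFinite (bondsIn k (s'.Ω (k + 1))ᶜ)).toFinset} => (HaarData.haar : Measure (SU N)))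
        (Measure.pi fun _ : {c : PBond (F.P p.K) (k + 1) // c ∉ (Set.toFinite (bondsIn (k + 1) (s'.Ω (k + 1))ᶜ)).toFinset} => (HaarData.haar : Measure (SU N)))
        (fun u => fun c : {c : PBond (F.P p.K) (k + 1) // c ∉ (Set.toFinite (bondsIn (k + 1) (s'.Ω (k + 1))ᶜ)).toFinset} =>
          (avOfRecord F N p.K k).avg
            ((MeasurableEquiv.piEquivPiSubtypeProd (fun _ : PBond (F.P p.K) k => SU N)
              (· ∈ (Set.toFinite (bondsIn k (s'.Ω (k + 1))ᶜ)).toFinset)).symm (y, u)) c)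
        (fun u => ρ ((MeasurableEquiv.piEquivPiSubtypeProd (fun _ : PBond (F.P p.K) k => SU N)
            (· ∈ (Set.toFinite (bondsIn k (s'.Ω (k + 1))ᶜ)).toFinset)).symm (y, u))) :=
  ae_condExp_section_ae_eq_fibreTransport_at_record F N p.K k (hdec := hdec) (hdec' := hdec') hk (toFine_mem_compl_Omega_iff s' hk)
    (fun b hb => (mem_toFinite_bondsIn_toFinset_iff _ b).1 hb) (fun c hc => (mem_toFinite_bondsIn_toFinset_iff _ c).2 hc) hρ

/-- ★★★ **(hce₀) ⟹ (hfib) at 11a's generation letters** — THE CONVERSE of dag-n11-d's `condExp_identity_of_fibrewise[_of_nonneg]` (p649025): if def-T's skew conditional expectation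
of `ρ ∘ e` IS `R` a.e., then for a.e. retained configuration `y` and EVERY bounded measurable `h` of the new variables alone the frozen-`y` identity holds with candidate `R`.  No
hypothesis but `k + 1 ≤ m + K` (joint AC by p615032's `…_skew_absolutelyContinuous_Omega`).
[cite: Balaban1988Convergent, (2.21) p.258, (3.1) p.264, (3.10)–(3.14) pp.266–267, (3.23)–(3.25) p.270; Balaban1987RG1, (0.4) p.253, §2 p.267] -/
theorem fibrewise_of_condExp_Omega (ν : Stage7Numerics) (M : ℕ) (g : ℕ → ℝ) (p : B12.RunParams)
    {k : ℕ} {hdec : DecidableEq (PBond (F.P p.K) k)} {hdec' : DecidableEq (PBond (F.P p.K) (k + 1))} (hk : k + 1 ≤ (F.P p.K).m + (F.P p.K).K)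
    (s' : SeqOfRecord F ν M g p.K (k + 1)) {ρ : GaugeField (F.P p.K) k (SU N) → ℝ} (hρ : Integrable ρ (fieldMeasure (F.P p.K) k (SU N)))
    {R : ((↥(Set.toFinite (bondsIn k (s'.Ω (k + 1))ᶜ)).toFinset → SU N) × ({c : PBond (F.P p.K) (k + 1) // c ∉ (Set.toFinite (bondsIn (k + 1) (s'.Ω (k + 1))ᶜ)).toFinset} → SU N)) → ℝ}
    (hce : kernelTransport
        ((Measure.pi fun _ : ↥(Set.toFinite (bondsIn k (s'.Ω (k + 1))ᶜ)).toFinset => (HaarData.haar : Measure (SU N))).prod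
          (Measure.pi fun _ : {b : PBond (F.P p.K) k // b ∉ (Set.toFinite (bondsIn k (s'.Ω (k + 1))ᶜ)).toFinset} => (HaarData.haar : Measure (SU N))))
        ((Measure.pi fun _ : ↥(Set.toFinite (bondsIn k (s'.Ω (k + 1))ᶜ)).toFinset => (HaarData.haar : Measure (SU N))).prod
          (Measure.pi fun _ : {c : PBond (F.P p.K) (k + 1) // c ∉ (Set.toFinite (bondsIn (k + 1) (s'.Ω (k + 1))ᶜ)).toFinset} =>
            (HaarData.haar : Measure (SU N))))
        (fun q => (q.1, fun c : {c : PBond (F.P p.K) (k + 1) // c ∉ (Set.toFinite (bondsIn (k + 1) (s'.Ω (k + 1))ᶜ)).toFinset} =>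
          (avOfRecord F N p.K k).avg
            ((MeasurableEquiv.piEquivPiSubtypeProd (fun _ : PBond (F.P p.K) k => SU N)
              (· ∈ (Set.toFinite (bondsIn k (s'.Ω (k + 1))ᶜ)).toFinset)).symm q) c))
        (ρ ∘ ⇑(MeasurableEquiv.piEquivPiSubtypeProd (fun _ : PBond (F.P p.K) k => SU N)
            (· ∈ (Set.toFinite (bondsIn k (s'.Ω (k + 1))ᶜ)).toFinset)).symm)
      =ᵐ[((Measure.pi fun _ : ↥(Set.toFinite (bondsIn k (s'.Ω (k + 1))ᶜ)).toFinset => (HaarData.haar : Measure (SU N))).prod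
          (Measure.pi fun _ : {c : PBond (F.P p.K) (k + 1) // c ∉ (Set.toFinite (bondsIn (k + 1) (s'.Ω (k + 1))ᶜ)).toFinset} =>
            (HaarData.haar : Measure (SU N))))] R) :
    ∀ᵐ y ∂(Measure.pi fun _ : ↥(Set.toFinite (bondsIn k (s'.Ω (k + 1))ᶜ)).toFinset => (HaarData.haar : Measure (SU N))),
      ∀ h : ({c : PBond (F.P p.K) (k + 1) // c ∉ (Set.toFinite (bondsIn (k + 1) (s'.Ω (k + 1))ᶜ)).toFinset} → SU N) → ℝ, Measurable h → (∃ C : ℝ, ∀ v, |h v| ≤ C) →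
        ∫ u, ρ ((MeasurableEquiv.piEquivPiSubtypeProd (fun _ : PBond (F.P p.K) k => SU N)
              (· ∈ (Set.toFinite (bondsIn k (s'.Ω (k + 1))ᶜ)).toFinset)).symm (y, u)) *
            h (fun c : {c : PBond (F.P p.K) (k + 1) // c ∉ (Set.toFinite (bondsIn (k + 1) (s'.Ω (k + 1))ᶜ)).toFinset} =>
              (avOfRecord F N p.K k).avg ((MeasurableEquiv.piEquivPiSubtypeProd (fun _ : PBond (F.P p.K) k => SU N)
                (· ∈ (Set.toFinite (bondsIn k (s'.Ω (k + 1))ᶜ)).toFinset)).symm (y, u)) c)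
          ∂(Measure.pi fun _ : {b : PBond (F.P p.K) k // b ∉ (Set.toFinite (bondsIn k (s'.Ω (k + 1))ᶜ)).toFinset} => (HaarData.haar : Measure (SU N))) =
        ∫ v, R (y, v) * h v ∂(Measure.pi fun _ : {c : PBond (F.P p.K) (k + 1) // c ∉ (Set.toFinite (bondsIn (k + 1) (s'.Ω (k + 1))ᶜ)).toFinset} =>
          (HaarData.haar : Measure (SU N))) :=
  fibrewise_of_condExp_at_record F N p.K k (hdec := hdec) (hdec' := hdec') _ _ hρ
    (map_prod_avOfRecord_glue_skew_absolutelyContinuous_Omega (F := F) (N := N) p.K s' k hk) hce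

/-- ★★★ **(hce₀) ⟺ (hfib) at 11a's generation letters, candidate integrable** — `.mp` is FILE 2's `fibrewise_of_condExp`, `.mpr` IS dag-n11-d's `condExp_identity_of_fibrewise`
(p649025) BY NAME: the two roads compose and the displayed forms carry the same content.
[cite: Balaban1988Convergent, (2.21) p.258, (3.1) p.264, (3.23)–(3.25) p.270; Balaban1987RG1, (0.4) p.253, §2 p.267] -/
theorem condExp_iff_fibrewise_Omega (ν : Stage7Numerics) (M : ℕ) (g : ℕ → ℝ) (p : B12.RunParams)
    {k : ℕ} {hdec : DecidableEq (PBond (F.P p.K) k)} {hdec' : DecidableEq (PBond (F.P p.K) (k + 1))} (hk : k + 1 ≤ (F.P p.K).m + (F.P p.K).K)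
    (s' : SeqOfRecord F ν M g p.K (k + 1)) {ρ : GaugeField (F.P p.K) k (SU N) → ℝ} (hρ : Integrable ρ (fieldMeasure (F.P p.K) k (SU N)))
    {R : ((↥(Set.toFinite (bondsIn k (s'.Ω (k + 1))ᶜ)).toFinset → SU N) × ({c : PBond (F.P p.K) (k + 1) // c ∉ (Set.toFinite (bondsIn (k + 1) (s'.Ω (k + 1))ᶜ)).toFinset} → SU N)) → ℝ}
    (hRint : Integrable R ((Measure.pi fun _ : ↥(Set.toFinite (bondsIn k (s'.Ω (k + 1))ᶜ)).toFinset => (HaarData.haar : Measure (SU N))).prod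
          (Measure.pi fun _ : {c : PBond (F.P p.K) (k + 1) // c ∉ (Set.toFinite (bondsIn (k + 1) (s'.Ω (k + 1))ᶜ)).toFinset} =>
            (HaarData.haar : Measure (SU N))))) :
    kernelTransport
        ((Measure.pi fun _ : ↥(Set.toFinite (bondsIn k (s'.Ω (k + 1))ᶜ)).toFinset => (HaarData.haar : Measure (SU N))).prod
          (Measure.pi fun _ : {b : PBond (F.P p.K) k // b ∉ (Set.toFinite (bondsIn k (s'.Ω (k + 1))ᶜ)).toFinset} => (HaarData.haar : Measure (SU N))))
        ((Measure.pi fun _ : ↥(Set.toFinite (bondsIn k (s'.Ω (k + 1))ᶜ)).toFinset => (HaarData.haar : Measure (SU N))).prod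
          (Measure.pi fun _ : {c : PBond (F.P p.K) (k + 1) // c ∉ (Set.toFinite (bondsIn (k + 1) (s'.Ω (k + 1))ᶜ)).toFinset} =>
            (HaarData.haar : Measure (SU N))))
        (fun q => (q.1, fun c : {c : PBond (F.P p.K) (k + 1) // c ∉ (Set.toFinite (bondsIn (k + 1) (s'.Ω (k + 1))ᶜ)).toFinset} =>
          (avOfRecord F N p.K k).avg
            ((MeasurableEquiv.piEquivPiSubtypeProd (fun _ : PBond (F.P p.K) k => SU N)
              (· ∈ (Set.toFinite (bondsIn k (s'.Ω (k + 1))ᶜ)).toFinset)).symm q) c))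
        (ρ ∘ ⇑(MeasurableEquiv.piEquivPiSubtypeProd (fun _ : PBond (F.P p.K) k => SU N)
            (· ∈ (Set.toFinite (bondsIn k (s'.Ω (k + 1))ᶜ)).toFinset)).symm)
      =ᵐ[((Measure.pi fun _ : ↥(Set.toFinite (bondsIn k (s'.Ω (k + 1))ᶜ)).toFinset => (HaarData.haar : Measure (SU N))).prod
          (Measure.pi fun _ : {c : PBond (F.P p.K) (k + 1) // c ∉ (Set.toFinite (bondsIn (k + 1) (s'.Ω (k + 1))ᶜ)).toFinset} =>
            (HaarData.haar : Measure (SU N))))] R ↔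
    ∀ᵐ y ∂(Measure.pi fun _ : ↥(Set.toFinite (bondsIn k (s'.Ω (k + 1))ᶜ)).toFinset => (HaarData.haar : Measure (SU N))),
      ∀ h : ({c : PBond (F.P p.K) (k + 1) // c ∉ (Set.toFinite (bondsIn (k + 1) (s'.Ω (k + 1))ᶜ)).toFinset} → SU N) → ℝ, Measurable h → (∃ C : ℝ, ∀ v, |h v| ≤ C) →
        ∫ u, ρ ((MeasurableEquiv.piEquivPiSubtypeProd (fun _ : PBond (F.P p.K) k => SU N)
              (· ∈ (Set.toFinite (bondsIn k (s'.Ω (k + 1))ᶜ)).toFinset)).symm (y, u)) *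
            h (fun c : {c : PBond (F.P p.K) (k + 1) // c ∉ (Set.toFinite (bondsIn (k + 1) (s'.Ω (k + 1))ᶜ)).toFinset} =>
              (avOfRecord F N p.K k).avg ((MeasurableEquiv.piEquivPiSubtypeProd (fun _ : PBond (F.P p.K) k => SU N)
                (· ∈ (Set.toFinite (bondsIn k (s'.Ω (k + 1))ᶜ)).toFinset)).symm (y, u)) c)
          ∂(Measure.pi fun _ : {b : PBond (F.P p.K) k // b ∉ (Set.toFinite (bondsIn k (s'.Ω (k + 1))ᶜ)).toFinset} => (HaarData.haar : Measure (SU N))) =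
        ∫ v, R (y, v) * h v ∂(Measure.pi fun _ : {c : PBond (F.P p.K) (k + 1) // c ∉ (Set.toFinite (bondsIn (k + 1) (s'.Ω (k + 1))ᶜ)).toFinset} =>
          (HaarData.haar : Measure (SU N))) :=
  ⟨fibrewise_of_condExp_Omega ν M g p (hdec := hdec) (hdec' := hdec') hk s' hρ,
    condExp_identity_of_fibrewise ν M g p (hdec := hdec) (hdec' := hdec') hk s' hρ hRint⟩

/-- ★★★ **(hce₀) ⟺ (hfib) at 11a's generation letters, candidate nonnegative and measurable** — `.mpr` IS dag-n11-d's `condExp_identity_of_fibrewise_of_nonneg` BY NAME.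
[cite: Balaban1988Convergent, (2.21) p.258, (3.1) p.264, (3.23)–(3.25) p.270; Balaban1987RG1, (0.4) p.253, §2 p.267] -/
theorem condExp_iff_fibrewise_of_nonneg_Omega (ν : Stage7Numerics) (M : ℕ) (g : ℕ → ℝ) (p : B12.RunParams)
    {k : ℕ} {hdec : DecidableEq (PBond (F.P p.K) k)} {hdec' : DecidableEq (PBond (F.P p.K) (k + 1))} (hk : k + 1 ≤ (F.P p.K).m + (F.P p.K).K)
    (s' : SeqOfRecord F ν M g p.K (k + 1)) {ρ : GaugeField (F.P p.K) k (SU N) → ℝ} (hρ : Integrable ρ (fieldMeasure (F.P p.K) k (SU N)))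
    {R : ((↥(Set.toFinite (bondsIn k (s'.Ω (k + 1))ᶜ)).toFinset → SU N) × ({c : PBond (F.P p.K) (k + 1) // c ∉ (Set.toFinite (bondsIn (k + 1) (s'.Ω (k + 1))ᶜ)).toFinset} → SU N)) → ℝ}
    (hR0 : ∀ z, 0 ≤ R z) (hRm : Measurable R) :
    kernelTransport
        ((Measure.pi fun _ : ↥(Set.toFinite (bondsIn k (s'.Ω (k + 1))ᶜ)).toFinset => (HaarData.haar : Measure (SU N))).prod
          (Measure.pi fun _ : {b : PBond (F.P p.K) k // b ∉ (Set.toFinite (bondsIn k (s'.Ω (k + 1))ᶜ)).toFinset} => (HaarData.haar : Measure (SU N))))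
        ((Measure.pi fun _ : ↥(Set.toFinite (bondsIn k (s'.Ω (k + 1))ᶜ)).toFinset => (HaarData.haar : Measure (SU N))).prod
          (Measure.pi fun _ : {c : PBond (F.P p.K) (k + 1) // c ∉ (Set.toFinite (bondsIn (k + 1) (s'.Ω (k + 1))ᶜ)).toFinset} =>
            (HaarData.haar : Measure (SU N))))
        (fun q => (q.1, fun c : {c : PBond (F.P p.K) (k + 1) // c ∉ (Set.toFinite (bondsIn (k + 1) (s'.Ω (k + 1))ᶜ)).toFinset} =>
          (avOfRecord F N p.K k).avg
            ((MeasurableEquiv.piEquivPiSubtypeProd (fun _ : PBond (F.P p.K) k => SU N)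
              (· ∈ (Set.toFinite (bondsIn k (s'.Ω (k + 1))ᶜ)).toFinset)).symm q) c))
        (ρ ∘ ⇑(MeasurableEquiv.piEquivPiSubtypeProd (fun _ : PBond (F.P p.K) k => SU N)
            (· ∈ (Set.toFinite (bondsIn k (s'.Ω (k + 1))ᶜ)).toFinset)).symm)
      =ᵐ[((Measure.pi fun _ : ↥(Set.toFinite (bondsIn k (s'.Ω (k + 1))ᶜ)).toFinset => (HaarData.haar : Measure (SU N))).prod
          (Measure.pi fun _ : {c : PBond (F.P p.K) (k + 1) // c ∉ (Set.toFinite (bondsIn (k + 1) (s'.Ω (k + 1))ᶜ)).toFinset} =>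
            (HaarData.haar : Measure (SU N))))] R ↔
    ∀ᵐ y ∂(Measure.pi fun _ : ↥(Set.toFinite (bondsIn k (s'.Ω (k + 1))ᶜ)).toFinset => (HaarData.haar : Measure (SU N))),
      ∀ h : ({c : PBond (F.P p.K) (k + 1) // c ∉ (Set.toFinite (bondsIn (k + 1) (s'.Ω (k + 1))ᶜ)).toFinset} → SU N) → ℝ, Measurable h → (∃ C : ℝ, ∀ v, |h v| ≤ C) →
        ∫ u, ρ ((MeasurableEquiv.piEquivPiSubtypeProd (fun _ : PBond (F.P p.K) k => SU N)
              (· ∈ (Set.toFinite (bondsIn k (s'.Ω (k + 1))ᶜ)).toFinset)).symm (y, u)) *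
            h (fun c : {c : PBond (F.P p.K) (k + 1) // c ∉ (Set.toFinite (bondsIn (k + 1) (s'.Ω (k + 1))ᶜ)).toFinset} =>
              (avOfRecord F N p.K k).avg ((MeasurableEquiv.piEquivPiSubtypeProd (fun _ : PBond (F.P p.K) k => SU N)
                (· ∈ (Set.toFinite (bondsIn k (s'.Ω (k + 1))ᶜ)).toFinset)).symm (y, u)) c)
          ∂(Measure.pi fun _ : {b : PBond (F.P p.K) k // b ∉ (Set.toFinite (bondsIn k (s'.Ω (k + 1))ᶜ)).toFinset} => (HaarData.haar : Measure (SU N))) =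
        ∫ v, R (y, v) * h v ∂(Measure.pi fun _ : {c : PBond (F.P p.K) (k + 1) // c ∉ (Set.toFinite (bondsIn (k + 1) (s'.Ω (k + 1))ᶜ)).toFinset} =>
          (HaarData.haar : Measure (SU N))) :=
  ⟨fibrewise_of_condExp_Omega ν M g p (hdec := hdec) (hdec' := hdec') hk s' hρ,
    condExp_identity_of_fibrewise_of_nonneg ν M g p (hdec := hdec) (hdec' := hdec') hk s' hρ hR0 hRm⟩

/-- ★★ **p646357's (hweak) IS INHABITED BY THE TRUE CANDIDATE**: for every `dU`-integrable `ρ`, the weak identity holds with `R := kernelTransport μ_in μ_out skew (ρ ∘ e)` (def-T's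
push-forward identity along the skew map, joint AC by p615032). [cite: Balaban1988Convergent, (2.21) p.258, (3.1) p.264; Balaban1987RG1, (0.4) p.253] -/
theorem weak_kernelTransport_Omega (ν : Stage7Numerics) (M : ℕ) (g : ℕ → ℝ) (p : B12.RunParams)
    {k : ℕ} {hdec : DecidableEq (PBond (F.P p.K) k)} {hdec' : DecidableEq (PBond (F.P p.K) (k + 1))} (hk : k + 1 ≤ (F.P p.K).m + (F.P p.K).K)
    (s' : SeqOfRecord F ν M g p.K (k + 1)) {ρ : GaugeField (F.P p.K) k (SU N) → ℝ} (hρ : Integrable ρ (fieldMeasure (F.P p.K) k (SU N)))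
    (f : ((↥(Set.toFinite (bondsIn k (s'.Ω (k + 1))ᶜ)).toFinset → SU N) × ({c : PBond (F.P p.K) (k + 1) // c ∉ (Set.toFinite (bondsIn (k + 1) (s'.Ω (k + 1))ᶜ)).toFinset} → SU N)) → ℝ)
    (hf : Measurable f) (hC : ∃ C : ℝ, ∀ z, |f z| ≤ C) :
    ∫ q, (ρ ∘ ⇑(MeasurableEquiv.piEquivPiSubtypeProd (fun _ : PBond (F.P p.K) k => SU N)
            (· ∈ (Set.toFinite (bondsIn k (s'.Ω (k + 1))ᶜ)).toFinset)).symm) q *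
        f ((fun q => (q.1, fun c : {c : PBond (F.P p.K) (k + 1) // c ∉ (Set.toFinite (bondsIn (k + 1) (s'.Ω (k + 1))ᶜ)).toFinset} =>
          (avOfRecord F N p.K k).avg ((MeasurableEquiv.piEquivPiSubtypeProd (fun _ : PBond (F.P p.K) k => SU N)
            (· ∈ (Set.toFinite (bondsIn k (s'.Ω (k + 1))ᶜ)).toFinset)).symm q) c)) q)
        ∂((Measure.pi fun _ : ↥(Set.toFinite (bondsIn k (s'.Ω (k + 1))ᶜ)).toFinset => (HaarData.haar : Measure (SU N))).prod
          (Measure.pi fun _ : {b : PBond (F.P p.K) k // b ∉ (Set.toFinite (bondsIn k (s'.Ω (k + 1))ᶜ)).toFinset} => (HaarData.haar : Measure (SU N)))) =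
      ∫ z, kernelTransport
          ((Measure.pi fun _ : ↥(Set.toFinite (bondsIn k (s'.Ω (k + 1))ᶜ)).toFinset => (HaarData.haar : Measure (SU N))).prod
            (Measure.pi fun _ : {b : PBond (F.P p.K) k // b ∉ (Set.toFinite (bondsIn k (s'.Ω (k + 1))ᶜ)).toFinset} => (HaarData.haar : Measure (SU N))))
          ((Measure.pi fun _ : ↥(Set.toFinite (bondsIn k (s'.Ω (k + 1))ᶜ)).toFinset => (HaarData.haar : Measure (SU N))).prod
            (Measure.pi fun _ : {c : PBond (F.P p.K) (k + 1) // c ∉ (Set.toFinite (bondsIn (k + 1) (s'.Ω (k + 1))ᶜ)).toFinset} =>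
              (HaarData.haar : Measure (SU N))))
          (fun q => (q.1, fun c : {c : PBond (F.P p.K) (k + 1) // c ∉ (Set.toFinite (bondsIn (k + 1) (s'.Ω (k + 1))ᶜ)).toFinset} =>
            (avOfRecord F N p.K k).avg
              ((MeasurableEquiv.piEquivPiSubtypeProd (fun _ : PBond (F.P p.K) k => SU N)
                (· ∈ (Set.toFinite (bondsIn k (s'.Ω (k + 1))ᶜ)).toFinset)).symm q) c))
          (ρ ∘ ⇑(MeasurableEquiv.piEquivPiSubtypeProd (fun _ : PBond (F.P p.K) k => SU N)
              (· ∈ (Set.toFinite (bondsIn k (s'.Ω (k + 1))ᶜ)).toFinset)).symm) z * f z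
        ∂((Measure.pi fun _ : ↥(Set.toFinite (bondsIn k (s'.Ω (k + 1))ᶜ)).toFinset => (HaarData.haar : Measure (SU N))).prod
          (Measure.pi fun _ : {c : PBond (F.P p.K) (k + 1) // c ∉ (Set.toFinite (bondsIn (k + 1) (s'.Ω (k + 1))ᶜ)).toFinset} =>
            (HaarData.haar : Measure (SU N)))) := by
  have hpres := measurePreserving_piEquivPiSubtypeProd_symm_fieldMeasure (G := SU N) (P := F.P p.K) (j := k)
    (Set.toFinite (bondsIn k (s'.Ω (k + 1))ᶜ)).toFinset
  have hρ' := (hpres.integrable_comp hρ.aestronglyMeasurable).mpr hρ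
  exact weak_kernelTransport_skew _ _ _ hρ'
    (measurable_avOfRecord_glue_rest F N p.K k (Set.toFinite (bondsIn k (s'.Ω (k + 1))ᶜ)).toFinset (Set.toFinite (bondsIn (k + 1) (s'.Ω (k + 1))ᶜ)).toFinset)
    (map_prod_avOfRecord_glue_skew_absolutelyContinuous_Omega (F := F) (N := N) p.K s' k hk) f hf hC

/-- ★★ **p649025's (hfib) IS INHABITED BY THE TRUE CANDIDATE**: for every `dU`-integrable `ρ`, the frozen-`y` fibrewise identity holds with `R := kernelTransport μ_in μ_out skew (ρ ∘ e)`
— a non-trivial record witness of the displayed hypothesis, for every `ρ` (in particular every old graph piece); by ★★★ its sections are the fibre transports.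
[cite: Balaban1988Convergent, (2.21) p.258, (3.1) p.264, (3.10)–(3.14) pp.266–267, (3.23)–(3.25) p.270; Balaban1987RG1, (0.4) p.253, §2 p.267] -/
theorem fibrewise_kernelTransport_Omega (ν : Stage7Numerics) (M : ℕ) (g : ℕ → ℝ) (p : B12.RunParams)
    {k : ℕ} {hdec : DecidableEq (PBond (F.P p.K) k)} {hdec' : DecidableEq (PBond (F.P p.K) (k + 1))} (hk : k + 1 ≤ (F.P p.K).m + (F.P p.K).K)
    (s' : SeqOfRecord F ν M g p.K (k + 1)) {ρ : GaugeField (F.P p.K) k (SU N) → ℝ} (hρ : Integrable ρ (fieldMeasure (F.P p.K) k (SU N))) :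
    ∀ᵐ y ∂(Measure.pi fun _ : ↥(Set.toFinite (bondsIn k (s'.Ω (k + 1))ᶜ)).toFinset => (HaarData.haar : Measure (SU N))),
      ∀ h : ({c : PBond (F.P p.K) (k + 1) // c ∉ (Set.toFinite (bondsIn (k + 1) (s'.Ω (k + 1))ᶜ)).toFinset} → SU N) → ℝ, Measurable h → (∃ C : ℝ, ∀ v, |h v| ≤ C) →
        ∫ u, ρ ((MeasurableEquiv.piEquivPiSubtypeProd (fun _ : PBond (F.P p.K) k => SU N)
              (· ∈ (Set.toFinite (bondsIn k (s'.Ω (k + 1))ᶜ)).toFinset)).symm (y, u)) *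
            h (fun c : {c : PBond (F.P p.K) (k + 1) // c ∉ (Set.toFinite (bondsIn (k + 1) (s'.Ω (k + 1))ᶜ)).toFinset} =>
              (avOfRecord F N p.K k).avg ((MeasurableEquiv.piEquivPiSubtypeProd (fun _ : PBond (F.P p.K) k => SU N)
                (· ∈ (Set.toFinite (bondsIn k (s'.Ω (k + 1))ᶜ)).toFinset)).symm (y, u)) c)
          ∂(Measure.pi fun _ : {b : PBond (F.P p.K) k // b ∉ (Set.toFinite (bondsIn k (s'.Ω (k + 1))ᶜ)).toFinset} => (HaarData.haar : Measure (SU N))) =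
        ∫ v, kernelTransport
            ((Measure.pi fun _ : ↥(Set.toFinite (bondsIn k (s'.Ω (k + 1))ᶜ)).toFinset => (HaarData.haar : Measure (SU N))).prod
              (Measure.pi fun _ : {b : PBond (F.P p.K) k // b ∉ (Set.toFinite (bondsIn k (s'.Ω (k + 1))ᶜ)).toFinset} => (HaarData.haar : Measure (SU N))))
            ((Measure.pi fun _ : ↥(Set.toFinite (bondsIn k (s'.Ω (k + 1))ᶜ)).toFinset => (HaarData.haar : Measure (SU N))).prod
              (Measure.pi fun _ : {c : PBond (F.P p.K) (k + 1) // c ∉ (Set.toFinite (bondsIn (k + 1) (s'.Ω (k + 1))ᶜ)).toFinset} =>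
                (HaarData.haar : Measure (SU N))))
            (fun q => (q.1, fun c : {c : PBond (F.P p.K) (k + 1) // c ∉ (Set.toFinite (bondsIn (k + 1) (s'.Ω (k + 1))ᶜ)).toFinset} =>
              (avOfRecord F N p.K k).avg
                ((MeasurableEquiv.piEquivPiSubtypeProd (fun _ : PBond (F.P p.K) k => SU N)
                  (· ∈ (Set.toFinite (bondsIn k (s'.Ω (k + 1))ᶜ)).toFinset)).symm q) c))
            (ρ ∘ ⇑(MeasurableEquiv.piEquivPiSubtypeProd (fun _ : PBond (F.P p.K) k => SU N)
                (· ∈ (Set.toFinite (bondsIn k (s'.Ω (k + 1))ᶜ)).toFinset)).symm) (y, v) * h v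
          ∂(Measure.pi fun _ : {c : PBond (F.P p.K) (k + 1) // c ∉ (Set.toFinite (bondsIn (k + 1) (s'.Ω (k + 1))ᶜ)).toFinset} =>
            (HaarData.haar : Measure (SU N))) :=
  fibrewise_of_condExp_Omega ν M g p (hdec := hdec) (hdec' := hdec') hk s' hρ Filter.EventuallyEq.rfl

end Omega

/-! ## §3  The soft gauge-fixing law FIBRE BY FIBRE: inserting the Faddeev–Popov weight of (1.6) leaves a.e. every fibre transport unchanged -/

section GaugeFixingOnFibres

/-- ★★ **THE FADDEEV–POPOV WEIGHT UNDER THE δ-FUNCTION, FIBRE BY FIBRE** (this seat's p622555 ∕ p624257 `innerTransport_fpWeight_mul_ae_eq[_bondsIn_Omega]` read through FILE 2's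
★★★): at 11a's generation letters, for gauge-fixed centres `Yfp` with blocks INSIDE `Ω_{j+1}(s)`, `α > 0`, `ε₀ > 0`, and `ρ` integrable and invariant under the fine
transformations supported in the blocks over `Yfp`: for a.e. retained configuration `y`, the FIBRE transport of `u ↦ fpW(Yfp)(e(y,u))·ρ(e(y,u))` along `u ↦ (Ū(e(y,u))(c))_{c ∉ sV'}`
equals that of `u ↦ ρ(e(y,u))`, a.e. — [III] p.265 L.10–12's insertion of (1.5)⇒(1.6) performed INSIDE print's frozen-`y` integral (3.10)–(3.25).
[cite: Balaban1988Convergent, (1.5)–(1.6) p.247, p.265 L.10–12, (2.21) p.258, (3.1) p.264, (3.10)–(3.14) pp.266–267; Balaban1987RG1, (0.4) p.253, §2 p.267] -/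
theorem ae_fibreTransport_fpWeight_mul_ae_eq_Omega {ν : Stage7Numerics} {M : ℕ} {g : ℕ → ℝ} (K : ℕ) {n : ℕ} (s : SeqOfRecord F ν M g K n)
    (j : ℕ) [DecidableEq (PBond (F.P K) j)] [DecidableEq (PBond (F.P K) (j + 1))] (hj : j + 1 ≤ (F.P K).m + (F.P K).K)
    {α ε₀ : ℝ} (hα : 0 < α) (hε : 0 < ε₀)
    (Yfp : Finset (Site (F.P K) (j + 1))) (hYfp : ∀ y ∈ Yfp, toFine (j + 1) y ∈ s.Ω (j + 1))
    {ρ : Density (F.P K) j (SU N)}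
    (hρ : ∀ u : GaugeTransf (F.P K) j (SU N), FineGauge u → (∀ x, blockOf x ∉ Yfp → u x = 1) → ∀ U, ρ (gaugeAct u U) = ρ U)
    (hρi : Integrable ρ (fieldMeasure (F.P K) j (SU N))) :
    ∀ᵐ y ∂(Measure.pi fun _ : ↥(Set.toFinite (bondsIn j (s.Ω (j + 1))ᶜ)).toFinset => (HaarData.haar : Measure (SU N))),
      kernelTransport
          (Measure.pi fun _ : {b : PBond (F.P K) j // b ∉ (Set.toFinite (bondsIn j (s.Ω (j + 1))ᶜ)).toFinset} => (HaarData.haar : Measure (SU N)))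
          (Measure.pi fun _ : {c : PBond (F.P K) (j + 1) // c ∉ (Set.toFinite (bondsIn (j + 1) (s.Ω (j + 1))ᶜ)).toFinset} => (HaarData.haar : Measure (SU N)))
          (fun u => fun c : {c : PBond (F.P K) (j + 1) // c ∉ (Set.toFinite (bondsIn (j + 1) (s.Ω (j + 1))ᶜ)).toFinset} =>
            (avOfRecord F N K j).avg ((MeasurableEquiv.piEquivPiSubtypeProd (fun _ : PBond (F.P K) j => SU N)
              (· ∈ (Set.toFinite (bondsIn j (s.Ω (j + 1))ᶜ)).toFinset)).symm (y, u)) c)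
          (fun u => (∏ y' ∈ Yfp, ∏ x ∈ (block y').erase (emb y'),
              (B16ZLower.zNorm (SU N) α ε₀)⁻¹ * fpIntegrand α ε₀ ((contourOfRecord F N K j).holTo
                ((MeasurableEquiv.piEquivPiSubtypeProd (fun _ : PBond (F.P K) j => SU N) (· ∈ (Set.toFinite (bondsIn j (s.Ω (j + 1))ᶜ)).toFinset)).symm (y, u)) y' x)) *
            ρ ((MeasurableEquiv.piEquivPiSubtypeProd (fun _ : PBond (F.P K) j => SU N) (· ∈ (Set.toFinite (bondsIn j (s.Ω (j + 1))ᶜ)).toFinset)).symm (y, u)))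
        =ᵐ[Measure.pi fun _ : {c : PBond (F.P K) (j + 1) // c ∉ (Set.toFinite (bondsIn (j + 1) (s.Ω (j + 1))ᶜ)).toFinset} => (HaarData.haar : Measure (SU N))]
      kernelTransport
          (Measure.pi fun _ : {b : PBond (F.P K) j // b ∉ (Set.toFinite (bondsIn j (s.Ω (j + 1))ᶜ)).toFinset} => (HaarData.haar : Measure (SU N)))
          (Measure.pi fun _ : {c : PBond (F.P K) (j + 1) // c ∉ (Set.toFinite (bondsIn (j + 1) (s.Ω (j + 1))ᶜ)).toFinset} => (HaarData.haar : Measure (SU N)))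
          (fun u => fun c : {c : PBond (F.P K) (j + 1) // c ∉ (Set.toFinite (bondsIn (j + 1) (s.Ω (j + 1))ᶜ)).toFinset} =>
            (avOfRecord F N K j).avg ((MeasurableEquiv.piEquivPiSubtypeProd (fun _ : PBond (F.P K) j => SU N)
              (· ∈ (Set.toFinite (bondsIn j (s.Ω (j + 1))ᶜ)).toFinset)).symm (y, u)) c)
          (fun u => ρ ((MeasurableEquiv.piEquivPiSubtypeProd (fun _ : PBond (F.P K) j => SU N)
            (· ∈ (Set.toFinite (bondsIn j (s.Ω (j + 1))ᶜ)).toFinset)).symm (y, u))) := by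
  have hpres := measurePreserving_piEquivPiSubtypeProd_symm_fieldMeasure (G := SU N) (P := F.P K) (j := j)
    (Set.toFinite (bondsIn j (s.Ω (j + 1))ᶜ)).toFinset
  have hρ' := (hpres.integrable_comp hρi.aestronglyMeasurable).mpr hρi
  have hwi := integrable_weight_mul (fieldMeasure (F.P K) j (SU N)) (contourOfRecord F N K j) (measurable_holTo_contourOfRecord F N K j)
    hα ε₀ (B16ZLower.zNorm (SU N) α ε₀) Yfp hρi
  have hw' := (hpres.integrable_comp hwi.aestronglyMeasurable).mpr hwi
  have hin := innerTransport_fpWeight_mul_ae_eq_bondsIn_Omega F N K s j hj hα hε Yfp hYfp hρ hρi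
  have key := ae_fibreTransport_congr_of_skew_ae_eq _ _ _ hw' hρ'
    (measurable_avOfRecord_glue_rest F N K j (Set.toFinite (bondsIn j (s.Ω (j + 1))ᶜ)).toFinset (Set.toFinite (bondsIn (j + 1) (s.Ω (j + 1))ᶜ)).toFinset)
    (map_pi_avOfRecord_glue_fibre_absolutelyContinuous_Omega K s j hj) hin
  filter_upwards [key] with y hy
  simpa only [Function.comp_apply] using hy

end GaugeFixingOnFibres

end Summit.QuantumFields.YangMills.Theorems.BalabanUVNodesN11CondExpFibreSectionsOmega

end
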